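import Mathlib
import Summits.ValiantsHypothesis.ValiantsHypothesis.Theorems.FifoMatchingNNNotVPStubSupportFnHard
import HarnessLib

/-!
# Route FifoMatching — crux `NNNotVP` (stmt-ValiantsHypothesis-11615), line `division_split`:
# the CLIQUE GADGET of nest-free perfect-matching existence, exposed by name

Registered line `Cruxes/NNNotVP/Lines/division_split.lean`; objects `σ` / `NN` / `SuppFn` = the
line's vocabulary (`Theorems/FifoMatchingNNNotVPDivisionSplitDefs.lean`).

The landed proof of stub A (`stub_supportFnHard`, ✓ p821759) builds, INSIDE its proof term, a
MONOTONE PROJECTION `e : σ n → E(K_m) ⊕ Bool` (every arc variable of `[2n]` becomes an edge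
variable of `K_m` or a constant) under which nest-free perfect-matching EXISTENCE on `[2n]`
ACCEPTS the clique vector of every `⌊√m⌋`-set and REJECTS the colouring vector of every
`(⌊√m⌋-1)`-colouring, with `n ≤ m^{12}` along a sequence `n(m)` (the clique token program
`cliqueLab`, `cliqueLab_run_cliqueVec` / `cliqueLab_noRun_colorVec`, `exists_programProjection`),
and pads it to every large `n` with `n ≤ m^{13}` (`exists_padding_projection`).  That gadget is only
consumed there at QUASI-POLYNOMIAL rate.  This file states the gadget ON ITS OWN, so that other
rates (the EXPONENTIAL rate of the companion `…NfpmExpLowerBound`) can consume it by name: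

* `nfpm_cliqueGadget_seq` — the gadget along the sequence (`1 ≤ n ≤ m^{12}`, all `m ≥ 5`);
* `nfpm_cliqueGadget_of_seq` — padding: a gadget along a sequence with `n ≤ m^{C₀}` gives one at
  EVERY large `n` with `n ≤ m^{C₀+1}`;
* `nfpm_cliqueGadget` — the gadget at every large `n`, `n ≤ m^{13}`.

Proofs are the corresponding fragments of `stub_supportFnHard` / `supportFnHard_of_cliqueProjection_seq`
(same tree, same authorship line), re-assembled to END at the gadget statement.  Honest framing:
bookkeeping (no new mathematics); stubs Z / B2, the crux `NNNotVP` and `VP ≠ VNP` stay OPEN.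
No definitions, no named facts.
-/

noncomputable section

-- Sub = Summit single-conjunct layout: the duplicated namespace component is mandated by the tree.
set_option linter.dupNamespace false

namespace Summit.ValiantsHypothesis.ValiantsHypothesis.Theorems.FifoMatching.NNNotVP.DivisionSplit

open MvPolynomial Literature.Computability.AlgebraicComplexity
open Literature.Computability.Complexity
open scoped NNReal BigOperators Classical

/-- **The clique gadget along a sequence.**  For every `m ≥ 5` there are `n` with
`1 ≤ n ≤ m^{12}` and a projection `e : σ n → E(K_m) ⊕ Bool` under which nest-free perfect-matching
existence on `[2n]` accepts the clique vector of every `⌊√m⌋`-subset of `Fin m` and rejects the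
colouring vector of every `(⌊√m⌋ - 1)`-colouring (the clique token program `cliqueLab` of size
`k + R·N`, `k = ⌊√m⌋`, `R = 5k - 4`, `N = #Pos k m`, transported to `Fin N` and projected by
`exists_programProjection`). [folklore] -/
theorem nfpm_cliqueGadget_seq :
    ∃ m₀ : ℕ, ∀ m ≥ m₀, ∃ n : ℕ, 1 ≤ n ∧ n ≤ m ^ 12 ∧ ∃ e : σ n → KEdge m ⊕ Bool,
      (∀ Z : Finset (Fin m), Z.card = Nat.sqrt m →
        decide (SuppFn (NN n) (Finset.univ.filter fun a : σ n =>
          Sum.elim (cliqueVec Z) id (e a) = true)) = true) ∧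
      (∀ O : Fin m → Fin (Nat.sqrt m - 1),
        decide (SuppFn (NN n) (Finset.univ.filter fun a : σ n =>
          Sum.elim (colorVec O) id (e a) = true)) = false) := by
  refine ⟨5, fun m hm => ?_⟩
  -- parameters of the clique program
  set k : ℕ := Nat.sqrt m with hk_def
  have hk : 1 ≤ k := Nat.le_sqrt.2 (by omega)
  have hkm : k ≤ m := Nat.sqrt_le_self m
  set R : ℕ := 5 * k - 4 with hR_def
  have hR : R + 4 = 5 * k := by omega
  have hR0 : 0 < R := by omega
  set N : ℕ := Fintype.card (Pos k m) with hN_def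
  let φ : Fin N ≃o Pos k m := Fintype.orderIsoFinOfCardEq (Pos k m) rfl
  -- the projection of the transported program
  obtain ⟨e, he⟩ := exists_programProjection (KEdge m) k R N hR0
    (fun i q => lab0 i (φ q)) (fun j q q' => cliqueLab j (φ q) (φ q'))
  refine ⟨k + R * N, by omega, ?_, e, ?_, ?_⟩
  · -- size `k + R N ≤ m ^ 12`
    have hm2 : 2 ≤ m := by omega
    have pm : ∀ {a b i j : ℕ}, a ≤ m ^ i → b ≤ m ^ j → a * b ≤ m ^ (i + j) :=
      fun ha hb => by rw [pow_add]; exact Nat.mul_le_mul ha hb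
    have h1 : k ≤ m ^ 1 := by rw [pow_one]; exact hkm
    have hm1 : m ≤ m ^ 1 := by rw [pow_one]
    have h2 : m + 1 ≤ m ^ 2 := by nlinarith
    have h3 : 2 ≤ m ^ 1 := by rw [pow_one]; exact hm2
    have hRle : R ≤ m ^ 2 := by nlinarith
    have hN : N ≤ m ^ 9 := by
      rw [hN_def, card_pos]
      have := pm h1 (pm h2 (pm h3 (pm hm1 (pm h2 h2))))
      simpa using this
    have hRN : R * N ≤ m ^ 11 := by simpa using pm hRle hN
    have hpow : m ^ 11 ≤ m ^ 12 := Nat.pow_le_pow_right (by omega) (by omega)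
    have hpow' : m ^ 1 ≤ m ^ 11 := Nat.pow_le_pow_right (by omega) (by omega)
    have : m ^ 12 = m * m ^ 11 := by rw [pow_succ, mul_comm]
    nlinarith
  · -- ACCEPT: clique vectors
    intro Z hZ
    rw [he (cliqueVec Z), run_transport hR0 φ]
    exact cliqueLab_run_cliqueVec hk hR Z hZ
  · -- REJECT: colouring vectors
    intro O
    rw [← Bool.not_eq_true, he (colorVec O), run_transport hR0 φ]
    rintro ⟨P, hP, h0, hS⟩
    exact cliqueLab_noRun_colorVec hk hR (c := k - 1) (by omega) O P hP h0 hS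

/-- **Padding a gadget along a sequence to every large `n`.**  If for all large `m` there are SOME
`n`, `1 ≤ n ≤ m^{C₀}`, carrying the clique gadget of `K_m`, then EVERY large `N` carries the clique
gadget of some `K_m` with `N ≤ m^{C₀+1}`: take `m = ⌊N^{1/C₀}⌋` (so `m^{C₀} ≤ N ≤ m^{C₀+1}` once
`m ≥ 2^{C₀}`) and pad the gadget from `n(m) ≤ m^{C₀} ≤ N` to `N` along `exists_padding_projection`
(nest-free perfect matchings of a prefix block extend by consecutive pairs). [folklore] -/
theorem nfpm_cliqueGadget_of_seq (C₀ : ℕ)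
    (hP : ∃ m₀ : ℕ, ∀ m ≥ m₀, ∃ n : ℕ, 1 ≤ n ∧ n ≤ m ^ C₀ ∧ ∃ e : σ n → KEdge m ⊕ Bool,
      (∀ Z : Finset (Fin m), Z.card = Nat.sqrt m →
        decide (SuppFn (NN n) (Finset.univ.filter fun a : σ n =>
          Sum.elim (cliqueVec Z) id (e a) = true)) = true) ∧
      (∀ O : Fin m → Fin (Nat.sqrt m - 1),
        decide (SuppFn (NN n) (Finset.univ.filter fun a : σ n =>
          Sum.elim (colorVec O) id (e a) = true)) = false)) :
    ∃ n₀ : ℕ, ∀ n ≥ n₀, ∃ m : ℕ, n ≤ m ^ (C₀ + 1) ∧ ∃ e : σ n → KEdge m ⊕ Bool,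
      (∀ Z : Finset (Fin m), Z.card = Nat.sqrt m →
        decide (SuppFn (NN n) (Finset.univ.filter fun a : σ n =>
          Sum.elim (cliqueVec Z) id (e a) = true)) = true) ∧
      (∀ O : Fin m → Fin (Nat.sqrt m - 1),
        decide (SuppFn (NN n) (Finset.univ.filter fun a : σ n =>
          Sum.elim (colorVec O) id (e a) = true)) = false) := by
  obtain ⟨m₀, hm₀⟩ := hP
  -- for every large `N` a suitable `m` with `m₀ ≤ m`, `n(m) ≤ N ≤ m^(C₀+1)`
  have hchoice : ∃ N₀ : ℕ, ∀ N ≥ N₀, ∃ m ≥ m₀, m ^ C₀ ≤ N ∧ N ≤ m ^ (C₀ + 1) := by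
    rcases Nat.eq_zero_or_pos C₀ with hC | hC
    · subst hC
      refine ⟨1, fun N hN => ⟨max N m₀, le_max_right _ _, by simpa using hN, ?_⟩⟩
      simp
    · refine ⟨(max m₀ (2 ^ C₀)) ^ C₀, fun N hN => ?_⟩
      set m : ℕ := Nat.nthRoot C₀ N with hm
      have hmge : max m₀ (2 ^ C₀) ≤ m := (Nat.le_nthRoot_iff (by omega)).2 hN
      have hm₀ : m₀ ≤ m := le_trans (le_max_left _ _) hmge
      have hm2 : 2 ^ C₀ ≤ m := le_trans (le_max_right _ _) hmge
      refine ⟨m, hm₀, ?_, ?_⟩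
      · have hN0 : N ≠ 0 := by
          have : 1 ≤ (max m₀ (2 ^ C₀)) ^ C₀ := Nat.one_le_pow _ _ (by positivity)
          omega
        exact (Nat.pow_nthRoot_le_iff).2 (Or.inr hN0)
      · have h1 : N < (m + 1) ^ C₀ := Nat.lt_pow_nthRoot_add_one (by omega) N
        have h2m : 1 ≤ 2 ^ C₀ := Nat.one_le_two_pow
        have h2 : (m + 1) ^ C₀ ≤ (2 * m) ^ C₀ := Nat.pow_le_pow_left (by omega) _
        have h3 : (2 * m) ^ C₀ ≤ m ^ (C₀ + 1) := by
          rw [mul_pow, pow_succ, mul_comm]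
          exact Nat.mul_le_mul_left _ hm2
        omega
  obtain ⟨N₀, hN₀⟩ := hchoice
  refine ⟨max N₀ 1, fun N hN => ?_⟩
  obtain ⟨m, hmm₀, hmN, hNm⟩ := hN₀ N (le_trans (le_max_left _ _) hN)
  obtain ⟨n, hn1, hnm, e, hacc, hrej⟩ := hm₀ m hmm₀
  obtain ⟨eP, heP⟩ := exists_padding_projection (n' := n) (n := N) hn1 (hnm.trans hmN)
  -- the composite projection `σ N → σ n ⊕ Bool → E(K_m) ⊕ Bool`
  have key : ∀ y : KEdge m → Bool,
      decide (SuppFn (NN N) (Finset.univ.filter fun a : σ N =>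
        Sum.elim y id (Sum.elim (fun a' => e a') Sum.inr (eP a)) = true)) =
      decide (SuppFn (NN n) (Finset.univ.filter fun a : σ n => Sum.elim y id (e a) = true)) := by
    intro y
    rw [← heP (fun a' => Sum.elim y id (e a'))]
    have hfilter : (Finset.univ.filter fun a : σ N =>
          Sum.elim y id (Sum.elim (fun a' => e a') Sum.inr (eP a)) = true) =
        Finset.univ.filter fun a : σ N =>
          Sum.elim (fun a' => Sum.elim y id (e a')) id (eP a) = true := by
      apply Finset.filter_congr
      intro a _
      rcases eP a with a' | b
      · exact Iff.rfl
      · exact Iff.rfl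
    rw [hfilter]
  refine ⟨m, hNm, fun a => Sum.elim (fun a' => e a') Sum.inr (eP a), ?_, ?_⟩
  · intro Z hZ
    rw [key]
    exact hacc Z hZ
  · intro O
    rw [key]
    exact hrej O

/-- ★ **The clique gadget at every large `n`** (`nfpm_cliqueGadget_of_seq` ∘ `nfpm_cliqueGadget_seq`):
for all large `n` there are `m` with `n ≤ m^{13}` and a monotone projection
`e : σ n → E(K_m) ⊕ Bool` under which nest-free perfect-matching existence on `[2n]` is a
`(⌊√m⌋ - 1, ⌊√m⌋)`-clique-like function of `K_m` (accepts all `⌊√m⌋`-clique vectors, rejects all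
`(⌊√m⌋ - 1)`-colouring vectors).  Nest-free perfect-matching existence = shuffle-square recognition
is thus CLIQUE-hard under polynomial monotone projections. [folklore] -/
theorem nfpm_cliqueGadget :
    ∃ n₀ : ℕ, ∀ n ≥ n₀, ∃ m : ℕ, n ≤ m ^ 13 ∧ ∃ e : σ n → KEdge m ⊕ Bool,
      (∀ Z : Finset (Fin m), Z.card = Nat.sqrt m →
        decide (SuppFn (NN n) (Finset.univ.filter fun a : σ n =>
          Sum.elim (cliqueVec Z) id (e a) = true)) = true) ∧
      (∀ O : Fin m → Fin (Nat.sqrt m - 1),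
        decide (SuppFn (NN n) (Finset.univ.filter fun a : σ n =>
          Sum.elim (colorVec O) id (e a) = true)) = false) :=
  nfpm_cliqueGadget_of_seq 12 nfpm_cliqueGadget_seq

end Summit.ValiantsHypothesis.ValiantsHypothesis.Theorems.FifoMatching.NNNotVP.DivisionSplit

end
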